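import Literature.AlgebraicGeometry.Morphisms.RigidityLemma
import HarnessLib

/-!
# The rigidity lemma over a base from the STEIN property `𝒪_S ⥲ p_*𝒪_X` — the printed, non-reduced form of
# [MumfordFogartyKirwan1994, Ch. 6 §1, Prop. 6.1]

[MumfordFogartyKirwan1994, Ch. 6 §1, Proposition 6.1 (Rigidity lemma), pp. 115–116] (= [MumfordAV1970] §4 p. 43 over a
base): `p : X → S` proper flat with `H⁰(X_s, 𝒪_{X_s}) = κ(s)` for all `s`, a section `ε : S → X`, `S` connected,
`q : Y → S` separated, `f : X → Y` an `S`-morphism contracting the fibre over ONE point `s₀` to a point; then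
`f = (f ∘ ε) ∘ p`.  In print the cohomological hypothesis is used through its consequence «`𝒪_S → p_*𝒪_X` is an
isomorphism (universally)» (cohomology and base change), which needs NO reducedness of `X`.  The tree's
★ `Morphisms/RigidityLemma.rigidity` proves the lemma for REDUCED `X` (the `[GortzWedhorn2020] Prop. 9.2` ending);
THIS FILE proves it in the printed generality, with the hypothesis in exactly the form the proof uses:

* (Stein) for every open `W ⊆ S`, `Γ(W, 𝒪_S) → Γ(p⁻¹W, 𝒪_X)` is bijective (`hStein`; for an abelian scheme over a
  locally Noetherian base this is ★ `AbelianSchemeOver.app_bijective_of_isLocallyNoetherian`, [GortzWedhorn2023]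
  Cor. 24.63, with no reducedness hypothesis) — in fact only SURJECTIVITY on the tubes is used;
* `p` universally closed (closed map: tube lemma) and universally open (open map: the contracted locus is closed),
  `q` separated (equalisers are closed), `S` preconnected.

ARGUMENT (Mumford's): (1) `comp_eq_comp_of_forall_mem_affineOpen_of_surjective` — if every fibre over an open
`W ⊆ S` is mapped by `f` into ONE affine open `V ⊆ Y`, then `f` and `f ∘ ε ∘ p` AGREE ON THE TUBE `p⁻¹W ↪ X`: both
restrict to morphisms `p⁻¹W → V` into an affine scheme, determined by global sections (Mathlib `ext_of_isAffine`); every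
function on the tube comes from `W` (Stein) and is therefore detected by restriction along the section `ε|_W : W → p⁻¹W`,
where the two morphisms coincide.  (2) the tube lemma ★ `isOpen_setOf_fiber_subset` (`p` closed).  (3) `rigidity_of_stein`
— the set `T ⊆ S` of points whose fibre lies in the (closed) equaliser of `f` and `f ∘ ε ∘ p` is closed (`p` open) and
open (a fibre in the equaliser is contracted to `f(ε(s))`, which has an affine neighbourhood; (2) gives a tube mapped
into it; (1) puts the tube in the equaliser) and contains `s₀`; `S` preconnected ⇒ `T = S` ⇒ the tubes on which `f` and
`f ∘ ε ∘ p` agree COVER `X` ⇒ `f = f ∘ ε ∘ p` (Mathlib `Scheme.Cover.hom_ext`).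

Also the printed-hypotheses and factorisation forms.  Mathlib + ★ `RigidityLemma` only; theorems only; no named fact,
no `sorry`, no instance.  Cell hodgecm-mathlib, F-DAG (input (F) `lan2013_siegelFineModuliScheme`) leaf F-1a «rigidity
without reducedness» (price sheet `B-provers/B-p03/g16/F-DAG-PRICE.B-p03g16.md` §3 F-1, §5 first hand 1): it feeds
[MumfordFogartyKirwan1994] Cor. 6.2/6.4–6.6 and Serre's lemma over NON-reduced (e.g. Artinian) bases, i.e. the `classify`
clause of the fine moduli functor on arbitrary locally Noetherian test schemes.  HC_CM is proved only modulo the printed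
citations until rung 0 closes; this file discharges none of them.

## References
* [MumfordFogartyKirwan1994] D. Mumford, J. Fogarty, F. Kirwan, *Geometric Invariant Theory*, 3rd ed., Springer 1994,
  Ch. 6 §1, Prop. 6.1 (Rigidity lemma), pp. 115–116.
* [MumfordAV1970] D. Mumford, *Abelian Varieties*, §4, Rigidity lemma (p. 43).
* [GortzWedhorn2023] U. Görtz, T. Wedhorn, *Algebraic Geometry II* (2023), Cor. 24.63 (p. 404) (Stein property of
  proper flat morphisms with geometrically reduced connected fibres).
-/

noncomputable section

universe u

open CategoryTheory CategoryTheory.Limits AlgebraicGeometry TopologicalSpace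

namespace Literature.AlgebraicGeometry.Morphisms

variable {X Y S : Scheme.{u}}

/-! ### §1 A tube all of whose functions come from the base, mapped into an affine open, is contracted -/

/-- **Key step of the rigidity lemma, tube form** ([MumfordFogartyKirwan1994] Prop. 6.1, proof; [MumfordAV1970] §4):
let `p : X → S` with a section `ε`, `f : X → Y` any morphism, and `W ⊆ S` an open set such that every function on the
tube `p⁻¹W` comes from `W` (`hW`: `Γ(W, 𝒪_S) → Γ(p⁻¹W, 𝒪_X)` — as the global sections of the restricted morphism
`p|_W : p⁻¹W → W` — is onto) and such that `f` maps every fibre over `W` into ONE affine open `V ⊆ Y`.  Then `f` and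
`f ∘ ε ∘ p` AGREE ON THE TUBE `p⁻¹W ↪ X`. [cite: MumfordFogartyKirwan1994, Ch. 6 §1 Proposition 6.1 (pp. 115–116), proof]
[cite: MumfordAV1970, §4 Rigidity lemma (p. 43), proof] -/
theorem comp_eq_comp_of_forall_mem_affineOpen_of_surjective {p : X ⟶ S} (f : X ⟶ Y) (ε : S ⟶ X)
    (hε : ε ≫ p = 𝟙 S) (W : S.Opens) (hW : Function.Surjective (p ∣_ W).appTop.hom)
    {V : Y.Opens} (hV : IsAffineOpen V) (hWV : ∀ x : X, p.base x ∈ W → f.base x ∈ V) :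
    (p ⁻¹ᵁ W).ι ≫ f = (p ⁻¹ᵁ W).ι ≫ p ≫ ε ≫ f := by
  have hεp : ∀ t : S, p.base (ε.base t) = t := fun t => by
    rw [← Scheme.Hom.comp_apply, hε]
    rfl
  -- the section `ε|_W : W → p⁻¹W` of `p|_W`
  have hrange : Set.range (W.ι ≫ ε).base ⊆ Set.range (p ⁻¹ᵁ W).ι.base := by
    rw [Scheme.Opens.range_ι]
    rintro _ ⟨w, rfl⟩
    show p.base ((W.ι ≫ ε).base w) ∈ W
    rw [Scheme.Hom.comp_apply, hεp]
    exact w.2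
  let e : (W : Scheme.{u}) ⟶ (p ⁻¹ᵁ W : Scheme.{u}) := IsOpenImmersion.lift (p ⁻¹ᵁ W).ι (W.ι ≫ ε) hrange
  have he_ι : e ≫ (p ⁻¹ᵁ W).ι = W.ι ≫ ε := IsOpenImmersion.lift_fac _ _ _
  have he_π : e ≫ (p ∣_ W) = 𝟙 _ := by
    rw [← cancel_mono W.ι, Category.assoc, morphismRestrict_ι, ← Category.assoc, he_ι, Category.assoc, hε,
      Category.comp_id, Category.id_comp]
  -- points of the tube lie over `W`
  have htube : ∀ x' : ↥(p ⁻¹ᵁ W), p.base ((p ⁻¹ᵁ W).ι.base x') ∈ W := fun x' => by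
    have hx : (p ⁻¹ᵁ W).ι.base x' ∈ (p ⁻¹ᵁ W : Set X) := by
      rw [← Scheme.Opens.range_ι]
      exact ⟨x', rfl⟩
    exact hx
  -- the second map factors through `W`
  have hb : (p ⁻¹ᵁ W).ι ≫ p ≫ ε ≫ f = (p ∣_ W) ≫ W.ι ≫ ε ≫ f := by
    rw [← Category.assoc, ← morphismRestrict_ι, Category.assoc]
  -- both maps land in `V`
  have ha' : Set.range ((p ⁻¹ᵁ W).ι ≫ f).base ⊆ Set.range V.ι.base := by
    rw [Scheme.Opens.range_ι]
    rintro _ ⟨x', rfl⟩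
    rw [Scheme.Hom.comp_apply]
    exact hWV _ (htube x')
  have hb' : Set.range ((p ⁻¹ᵁ W).ι ≫ p ≫ ε ≫ f).base ⊆ Set.range V.ι.base := by
    rw [Scheme.Opens.range_ι]
    rintro _ ⟨x', rfl⟩
    rw [Scheme.Hom.comp_apply, Scheme.Hom.comp_apply, Scheme.Hom.comp_apply]
    refine hWV _ ?_
    rw [hεp]
    exact htube x'
  -- lift them to `V`, an affine scheme
  haveI : IsAffine (V : Scheme.{u}) := hV
  suffices hlift : IsOpenImmersion.lift V.ι _ ha' = IsOpenImmersion.lift V.ι _ hb' by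
    rw [← IsOpenImmersion.lift_fac V.ι _ ha', ← IsOpenImmersion.lift_fac V.ι _ hb', hlift]
  -- the lifts agree after the section `e`
  have key : e ≫ IsOpenImmersion.lift V.ι _ ha' = e ≫ IsOpenImmersion.lift V.ι _ hb' := by
    rw [← cancel_mono V.ι, Category.assoc, Category.assoc, IsOpenImmersion.lift_fac, IsOpenImmersion.lift_fac,
      hb, ← Category.assoc e (p ∣_ W), he_π, Category.id_comp, ← Category.assoc e (p ⁻¹ᵁ W).ι, he_ι,
      Category.assoc]
  -- `e^* ∘ (p|_W)^* = id` on global sections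
  have hret : ∀ l, e.appTop.hom ((p ∣_ W).appTop.hom l) = l := fun l => by
    rw [← CommRingCat.comp_apply, ← Scheme.Hom.comp_appTop, he_π, Scheme.Hom.id_appTop]
    rfl
  refine ext_of_isAffine (CommRingCat.hom_ext (RingHom.ext fun r => ?_))
  obtain ⟨l₁, hl₁⟩ := hW ((IsOpenImmersion.lift V.ι _ ha').appTop.hom r)
  obtain ⟨l₂, hl₂⟩ := hW ((IsOpenImmersion.lift V.ι _ hb').appTop.hom r)
  have heq := congrArg (fun φ => φ.appTop.hom r) key
  simp only [Scheme.Hom.comp_appTop, CommRingCat.hom_comp, RingHom.comp_apply] at heq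
  have hl : l₁ = l₂ := by
    rw [← hret l₁, ← hret l₂, hl₁, hl₂]
    exact heq
  rw [← hl₁, ← hl₂, hl]

/-- The Stein bijection `Γ(W, 𝒪_S) ⥲ Γ(p⁻¹W, 𝒪_X)` in `Scheme.Hom.app` currency gives surjectivity of the global
sections of the restricted morphism `p|_W : p⁻¹W → W` (Mathlib `morphismRestrict_appTop`: the two differ by the
transport isomorphism along `W.ι(⊤) = W`). [cite: MumfordFogartyKirwan1994, Ch. 6 §1 Proposition 6.1 (pp. 115–116), proof] -/
theorem surjective_morphismRestrict_appTop_of_bijective_app (p : X ⟶ S) (W : S.Opens)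
    (hW : Function.Bijective (p.app (W.ι ''ᵁ ⊤)).hom) : Function.Surjective (p ∣_ W).appTop.hom := by
  rw [morphismRestrict_appTop]
  intro r
  obtain ⟨a, ha⟩ := (ConcreteCategory.bijective_of_isIso
    (X.presheaf.map (eqToHom (image_morphismRestrict_preimage p W ⊤)).op)).2 r
  obtain ⟨b, hb⟩ := hW.2 a
  refine ⟨b, ?_⟩
  change (X.presheaf.map (eqToHom (image_morphismRestrict_preimage p W ⊤)).op).hom ((p.app (W.ι ''ᵁ ⊤)).hom b) = r
  rw [hb]
  exact ha

/-! ### §2 The rigidity lemma from the Stein property -/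

/-- **RIGIDITY LEMMA OVER A BASE, STEIN FORM** ([MumfordFogartyKirwan1994] Ch. 6 §1 Prop. 6.1; [MumfordAV1970] §4) —
NO reducedness.  Let `p : X → S` be universally closed and universally open (e.g. proper and flat of finite
presentation) with a section `ε : S → X`, such that every function on every tube comes from the base
(`hStein : Γ(W, 𝒪_S) → Γ(p⁻¹W, 𝒪_X)` onto for all open `W`, as the global sections of `p|_W`), and let `S` be
(pre)connected.  Let `q : Y → S` be separated and `f : X → Y` an `S`-morphism which maps the fibre over ONE point `s₀`
to a single point `y₀ ∈ Y`.  Then `f = (f ∘ ε) ∘ p`: `f` factors through the base, contracting every fibre.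
[cite: MumfordFogartyKirwan1994, Ch. 6 §1 Proposition 6.1 (Rigidity lemma) (pp. 115–116)] [cite: MumfordAV1970, §4 Rigidity lemma (p. 43)] -/
theorem rigidity_of_surjective {p : X ⟶ S} {q : Y ⟶ S} [UniversallyClosed p] [UniversallyOpen p]
    [IsSeparated q] [PreconnectedSpace S] (f : X ⟶ Y) (hf : f ≫ q = p) (ε : S ⟶ X) (hε : ε ≫ p = 𝟙 S)
    (hStein : ∀ W : S.Opens, Function.Surjective (p ∣_ W).appTop.hom)
    {s₀ : S} {y₀ : Y} (h₀ : ∀ x : X, p.base x = s₀ → f.base x = y₀) :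
    f = p ≫ ε ≫ f := by
  have hg : (p ≫ ε ≫ f) ≫ q = p := by
    rw [Category.assoc, Category.assoc, hf, hε, Category.comp_id]
  have hεp : ∀ t : S, p.base (ε.base t) = t := fun t => by
    rw [← Scheme.Hom.comp_apply, hε]
    rfl
  -- the equaliser of `f` and `p ≫ ε ≫ f` in `Over S`: a closed subscheme of `X` since `q` is separated
  let X' : Over S := Over.mk p
  let Y' : Over S := Over.mk q
  let f' : X' ⟶ Y' := Over.homMk f hf
  let g' : X' ⟶ Y' := Over.homMk (p ≫ ε ≫ f) hg
  haveI : IsSeparated Y'.hom := ‹IsSeparated q›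
  let ι : (equalizer f' g').left ⟶ X := (equalizer.ι f' g').left
  have hι : ι ≫ f = ι ≫ p ≫ ε ≫ f := congrArg CommaMorphism.left (equalizer.condition f' g')
  haveI : IsClosedImmersion ι := isClosedImmersion_equalizer_ι_left f' g'
  let E : Set X := Set.range ι.base
  have hEc : IsClosed E := ι.isClosedEmbedding.isClosed_range
  -- (b) if `f` and `p ≫ ε ≫ f` agree on the tube over `W`, every fibre over `W` lies in `E`
  have hb : ∀ W : S.Opens, (p ⁻¹ᵁ W).ι ≫ f = (p ⁻¹ᵁ W).ι ≫ p ≫ ε ≫ f →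
      ∀ x : X, p.base x ∈ W → x ∈ E := by
    intro W hW x hx
    obtain ⟨x', rfl⟩ : x ∈ Set.range (p ⁻¹ᵁ W).ι.base := by
      rw [Scheme.Opens.range_ι]
      exact hx
    let t : Over.mk ((p ⁻¹ᵁ W).ι ≫ p) ⟶ X' := Over.homMk (p ⁻¹ᵁ W).ι rfl
    have ht : t ≫ f' = t ≫ g' := by
      ext : 1
      exact hW
    refine ⟨(equalizer.lift t ht).left.base x', ?_⟩
    rw [← Scheme.Hom.comp_apply]
    change (equalizer.lift t ht ≫ equalizer.ι f' g').left.base x' = _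
    rw [equalizer.lift_ι]
    rfl
  -- points of `E` have `f x = f (ε (p x))`
  have hpt : ∀ x ∈ E, f.base x = f.base (ε.base (p.base x)) := by
    rintro _ ⟨y, rfl⟩
    rw [← Scheme.Hom.comp_apply, ← Scheme.Hom.comp_apply, ← Scheme.Hom.comp_apply, ← Scheme.Hom.comp_apply, hι]
  -- (K) a set-theoretically contracted fibre has a TUBE on which `f = p ≫ ε ≫ f`
  have hK : ∀ (s : S) (y : Y), (∀ x : X, p.base x = s → f.base x = y) →
      ∃ W : S.Opens, s ∈ W ∧ (p ⁻¹ᵁ W).ι ≫ f = (p ⁻¹ᵁ W).ι ≫ p ≫ ε ≫ f := by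
    intro s y hy
    obtain ⟨V, hV, hyV, -⟩ := exists_isAffineOpen_mem_and_subset (X := Y) (x := y) (U := ⊤) trivial
    let W : S.Opens := ⟨{u : S | ∀ x : X, p.base x = u → x ∈ f ⁻¹ᵁ V},
      isOpen_setOf_fiber_subset p p.isClosedMap (f ⁻¹ᵁ V)⟩
    refine ⟨W, fun x hx => ?_, comp_eq_comp_of_forall_mem_affineOpen_of_surjective f ε hε W (hStein W) hV ?_⟩
    · show f.base x ∈ V
      rw [hy x hx]
      exact hyV
    · intro x hx
      exact hx x rfl
  -- the set `T` of base points whose whole fibre lies in `E`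
  let T : Set S := {s : S | ∀ x : X, p.base x = s → x ∈ E}
  -- `T` is closed (`p` is open) and open
  have hTc : IsClosed T := by
    have hT : T = (p.base '' Eᶜ)ᶜ := by
      ext s
      simp only [T, Set.mem_setOf_eq, Set.mem_compl_iff, Set.mem_image, not_exists, not_and]
      constructor
      · intro h x hx hxs
        exact hx (h x hxs)
      · intro h x hxs
        by_contra hx
        exact h x hx hxs
    rw [hT, ← isOpen_compl_iff, compl_compl]
    exact p.isOpenMap _ hEc.isOpen_compl
  have hTo : IsOpen T := by
    rw [isOpen_iff_forall_mem_open]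
    intro s hs
    obtain ⟨W, hsW, hW⟩ := hK s (f.base (ε.base s)) fun x hx => by rw [hpt x (hs x hx), hx]
    exact ⟨(W : Set S), fun u hu x hx => hb W hW x (by rw [hx]; exact hu), W.2, hsW⟩
  -- `s₀ ∈ T`, so `T = S`
  have hs₀ : s₀ ∈ T := by
    obtain ⟨W, hsW, hW⟩ := hK s₀ y₀ h₀
    exact fun x hx => hb W hW x (by rw [hx]; exact hsW)
  have hT : T = Set.univ := IsClopen.eq_univ ⟨hTc, hTo⟩ ⟨s₀, hs₀⟩
  -- every point of `S` has a tube on which the two morphisms agree; the tubes cover `X`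
  have hall : ∀ s : S, ∃ W : S.Opens, s ∈ W ∧ (p ⁻¹ᵁ W).ι ≫ f = (p ⁻¹ᵁ W).ι ≫ p ≫ ε ≫ f := fun s => by
    have hs : s ∈ T := by
      rw [hT]
      exact Set.mem_univ _
    exact hK s (f.base (ε.base s)) fun x hx => by rw [hpt x (hs x hx), hx]
  choose W hsW hW using hall
  have hcov : IsOpenCover fun s : S => p ⁻¹ᵁ W s := by
    rw [IsOpenCover, eq_top_iff]
    intro x _
    rw [Opens.mem_iSup]
    exact ⟨p.base x, hsW (p.base x)⟩
  exact Scheme.Cover.hom_ext (X.openCoverOfIsOpenCover (fun s : S => p ⁻¹ᵁ W s) hcov) _ _ fun s => hW s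

/-- **Rigidity lemma, STEIN HYPOTHESIS in `Scheme.Hom.app` currency**: `Γ(W, 𝒪_S) → Γ(p⁻¹W, 𝒪_X)` bijective for
every open `W ⊆ S` (e.g. ★ `AbelianSchemeOver.app_bijective_of_isLocallyNoetherian`), `p` universally closed and
universally open with a section, `q` separated, `S` preconnected; an `S`-morphism contracting ONE fibre factors through
the base.  No reducedness. [cite: MumfordFogartyKirwan1994, Ch. 6 §1 Proposition 6.1 (Rigidity lemma) (pp. 115–116)]
[cite: MumfordAV1970, §4 Rigidity lemma (p. 43)] -/
theorem rigidity_of_stein {p : X ⟶ S} {q : Y ⟶ S} [UniversallyClosed p] [UniversallyOpen p]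
    [IsSeparated q] [PreconnectedSpace S] (f : X ⟶ Y) (hf : f ≫ q = p) (ε : S ⟶ X) (hε : ε ≫ p = 𝟙 S)
    (hStein : ∀ W : S.Opens, Function.Bijective (p.app W).hom)
    {s₀ : S} {y₀ : Y} (h₀ : ∀ x : X, p.base x = s₀ → f.base x = y₀) :
    f = p ≫ ε ≫ f :=
  rigidity_of_surjective f hf ε hε
    (fun W => surjective_morphismRestrict_appTop_of_bijective_app p W (hStein _)) h₀

/-- **Rigidity lemma, printed hypotheses, Stein form**: `p` universally closed, FLAT and locally of finite presentation
(hence universally open, Mathlib `UniversallyOpen.of_flat`), Stein, with a section, connected base; an `S`-morphism to a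
separated `S`-scheme contracting one fibre factors through the base. [cite: MumfordFogartyKirwan1994, Ch. 6 §1 Proposition 6.1 (Rigidity lemma) (pp. 115–116)] -/
theorem rigidity_of_flat_of_stein {p : X ⟶ S} {q : Y ⟶ S} [UniversallyClosed p] [Flat p]
    [LocallyOfFinitePresentation p] [IsSeparated q] [PreconnectedSpace S] (f : X ⟶ Y) (hf : f ≫ q = p)
    (ε : S ⟶ X) (hε : ε ≫ p = 𝟙 S) (hStein : ∀ W : S.Opens, Function.Bijective (p.app W).hom)
    {s₀ : S} {y₀ : Y} (h₀ : ∀ x : X, p.base x = s₀ → f.base x = y₀) :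
    f = p ≫ ε ≫ f :=
  rigidity_of_stein f hf ε hε hStein h₀

/-- **Rigidity lemma, factorisation form (Stein)**: `f = η ∘ p` for the `S`-section `η = f ∘ ε` of `q`.
[cite: MumfordFogartyKirwan1994, Ch. 6 §1 Proposition 6.1 (Rigidity lemma) (pp. 115–116)] -/
theorem exists_eq_comp_of_rigidity_of_stein {p : X ⟶ S} {q : Y ⟶ S} [UniversallyClosed p]
    [UniversallyOpen p] [IsSeparated q] [PreconnectedSpace S] (f : X ⟶ Y) (hf : f ≫ q = p) (ε : S ⟶ X)
    (hε : ε ≫ p = 𝟙 S) (hStein : ∀ W : S.Opens, Function.Bijective (p.app W).hom)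
    {s₀ : S} {y₀ : Y} (h₀ : ∀ x : X, p.base x = s₀ → f.base x = y₀) :
    ∃ η : S ⟶ Y, η ≫ q = 𝟙 S ∧ f = p ≫ η :=
  ⟨ε ≫ f, by rw [Category.assoc, hf, hε], rigidity_of_stein f hf ε hε hStein h₀⟩

/-- **All fibres are contracted** (set-theoretic corollary, Stein form): `f` is constant on every fibre of `p`, with value
`f (ε s)` on `p⁻¹(s)`. [cite: MumfordAV1970, §4 Rigidity lemma (p. 43)] -/
theorem apply_eq_apply_section_of_rigidity_of_stein {p : X ⟶ S} {q : Y ⟶ S} [UniversallyClosed p]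
    [UniversallyOpen p] [IsSeparated q] [PreconnectedSpace S] (f : X ⟶ Y) (hf : f ≫ q = p) (ε : S ⟶ X)
    (hε : ε ≫ p = 𝟙 S) (hStein : ∀ W : S.Opens, Function.Bijective (p.app W).hom)
    {s₀ : S} {y₀ : Y} (h₀ : ∀ x : X, p.base x = s₀ → f.base x = y₀) (x : X) :
    f.base x = f.base (ε.base (p.base x)) := by
  conv_lhs => rw [rigidity_of_stein f hf ε hε hStein h₀]
  rw [Scheme.Hom.comp_apply, Scheme.Hom.comp_apply]

end Literature.AlgebraicGeometry.Morphisms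

end
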